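import Summits.ResolutionOfSingularities.ResolutionOfSingularities.Theorems.FrobeniusLadderFInjectiveMacaulayficationChartModelNumerators
import Summits.ResolutionOfSingularities.ResolutionOfSingularities.Theorems.FrobeniusLadderFInjectiveMacaulayficationChartModelReadings
import Summits.ResolutionOfSingularities.ResolutionOfSingularities.Theorems.FrobeniusLadderFInjectiveMacaulayficationAffineBlowupChartRestriction
import Summits.ResolutionOfSingularities.ResolutionOfSingularities.Theorems.FrobeniusLadderFInjectiveMacaulayficationT11Char3Poly
import Summits.ResolutionOfSingularities.ResolutionOfSingularities.Theorems.FrobeniusLadderFInjectiveMacaulayficationT11Char7FanData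
import HarnessLib

/-!
# [OURS · L1 W4.5a] E7 R3 data half, file 2 `T11Char3R3Charts` — the bad curve of T₁₁/3 on the Rees charts: ONE generic chart theorem
# `ideal_closure_map_eq_of_data` (all certificate data as literal-list hypotheses, `decide`-able), for the instance's `hP″`

Crux `FrobeniusLadder.FInjectiveMacaulayfication` = stmt-ResolutionOfSingularities-15315 (chain w45a), hole 5e, E7 T₁₁/3 instance, R3 DATA
HALF (res-L1-w45a-plan-1 R13.19, res-L1-w45a-lead-1 NAMING 13:16:28Z; consumer `TwoLevelRoadFrame.pointFixable_of_chartModels(₂)`, binder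
`hP″ c : (𝓘(closure {ξ}).ideal (U c)).map (e c) ≤ (P″ c).map (ε c)` with `P″ c = I₂ c := (span ((T11Char3Poly.HS c).map evalL)).map mk`).
Helper `--supports stmt-ResolutionOfSingularities-15315 --as helper`, typed by res-type-034. OURS: replaces the role of NOTHING in H. Hironaka's
manuscript and is NOT a statement of it; AI-written kernel glue of the cell `res-hironaka`, weaker than expert review. No definition, no named fact.

SETTING (the instance's literal currency): `R̄ = k[X]⧸(f)` (`f` arbitrary here; the instance takes `f = T₁₁`), `I = (x̄^e : e ∈ T11Char7Fan.A)`,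
`w c = x̄^{m c}`, charts `U c = D₊(w_c t)` of `Bl_I Spec R̄`, pinned sections isomorphisms `e c` (`AffineBlowupChartTransport.exists_sectionsEquiv_eq`
form `hea`), chart models `θ c : k[y]⧸(g_c) ≃+* R̄[I/w_c]` with the C1-Kernel clause `(θ_c q̄).val = Ψ_c q`
(`MonomialChartPresentationKernel.exists_monomialChartPresentation`, `g_c = evalL (T11Char7Poly.G c)`), the curve's model ideals
`I₂ c = (span ((T11Char3Poly.HS c).map evalL)).map mk`, and `ξ ∈ U 64` with `𝔭_ξ(U 64)·e₆₄ = (I₂ 64)·θ₆₄` (the instance's `ξ`,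
from `AffineBlowupChartRestriction.exists_point_of_prime`).
* §1 small dictionary: `map_I₂_eq_span` (the model ideal pushed to `R̄[I/w_c]` is spanned by the `θ_c`-images of the `HS c` generators),
  `div_eq_theta_monomial` (an overlap unit `w_c/w_{c′}` IS `θ_{c′}` of a chart monomial, from one exponent identity), `evalL_single` /
  `evalL_binomial` (term lists of the Laurent-graph generators), `evalL_flatMap_zip` (Σ cofactor·generator as one term list);
* §2 **`ideal_closure_map_eq_of_data`**: for a chart `c` with (i) numerator tables of the three `HS 64` / `HS c` generators, (ii) one-monomial
  cofactor readings of each in the other chart, (iii) the Laurent-graph shape `(y_S, y^μ·y_r + 1)` of `HS c` up to permutation, (iv) a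
  cofactor certificate `g_c ∈ span (HS c)` mod 3, (v) the two overlap-unit exponent identities — ALL `decide`-able on literals —
  (assembled from §2's `forall₂_rel_of_raw`, `setOf_mem_HS_eq`, `isPrime_span_HS`, `monomial_not_mem_span_HS`, `evalL_G_mem_span_HS`,
  `mem_span_HS_of_mk_mem`, `isPrime_I₂`, `theta_monomial_not_mem`, `map_I₂_le_span_numerators`, `numerator_mem_map_I₂` — the last on
  `ChartModelReadings`' general relation, since cross-chart readings have `|e| > K`): `ξ ∈ U c` and
  **`(𝓘(closure {ξ}).ideal (U c)).map (e c) = (I₂ c).map (θ c)`** (via `AffineBlowupChartRestriction.map_ideal_closure_eq_of_memberships`,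
  `ChartModelNumerators.theta_mk_evalL_eq_reesChartEquiv`, `isPrime_span_laurentGraph`). The seven instantiations (charts 32, 33, 64, 65, 66,
  67, 68 of tri-1's `cert-T11-p3-tower.v1.json` 9b80b52d9fdbabd6; data by `HOME/plan/tools/res-type-034/r3data_compute.py`) and `exists_xi` /
  `hScover` follow in the companion file `T11Char3R3Data`.
References: folklore.
-/

-- single-problem summit: the doubled namespace component is forced
set_option linter.dupNamespace false

noncomputable section

open MvPolynomial AlgebraicGeometry Literature.AlgebraicGeometry.Resolution
open Summit.ResolutionOfSingularities.ResolutionOfSingularities.Theorems.FInjectiveMacaulayfication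

namespace Summit.ResolutionOfSingularities.ResolutionOfSingularities.Theorems.FInjectiveMacaulayfication.T11Char3R3Charts

variable (k : Type) [Field k] (f : MvPolynomial (Fin 4) k)

/-! ## §1 Small dictionary -/

/-- **The model ideal pushed to `R̄[I/w_c]` is spanned by the `θ_c`-images of the `HS c` generators.** [folklore] -/
theorem map_I₂_eq_span (c : Fin 87) (θ : ((MvPolynomial (Fin 4) k ⧸ Ideal.span {(KLocCellKit.evalL k (T11Char7Poly.G c))}) ≃+* ↥(blowupAlgebra (Ideal.span ((fun e : Fin 4 →₀ ℕ => Ideal.Quotient.mk (Ideal.span {f}) (monomial e (1 : k))) '' (T11Char7Fan.A : Set (Fin 4 →₀ ℕ)))) (Ideal.Quotient.mk (Ideal.span {f}) (monomial (T11Char7Fan.m c) (1 : k)))))) :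
    (((Ideal.span {x | x ∈ (T11Char3Poly.HS c).map (KLocCellKit.evalL k)}).map (Ideal.Quotient.mk (Ideal.span {(KLocCellKit.evalL k (T11Char7Poly.G c))})))).map θ = Ideal.span ((fun L : List (ℤ × (Fin 4 → ℕ)) => θ ((Ideal.Quotient.mk (Ideal.span {(KLocCellKit.evalL k (T11Char7Poly.G c))})) (KLocCellKit.evalL k L))) '' {L | L ∈ T11Char3Poly.HS c}) := by
  rw [Ideal.map_span, Ideal.map_span, Set.image_image]
  congr 1
  ext x
  simp only [Set.mem_image, Set.mem_setOf_eq, List.mem_map]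
  constructor
  · rintro ⟨y, ⟨L, hL, rfl⟩, rfl⟩
    exact ⟨L, hL, rfl⟩
  · rintro ⟨L, hL, rfl⟩
    exact ⟨_, ⟨L, hL, rfl⟩, rfl⟩

/-- Term list of a variable: `evalL [(1, e_s)] = y_s`. [folklore] -/
theorem evalL_single (s : Fin 4) : KLocCellKit.evalL k [((1 : ℤ), (Pi.single s 1 : Fin 4 → ℕ))] = X s := by
  have h : (Finsupp.equivFunOnFinite.symm (Pi.single s 1 : Fin 4 → ℕ) : Fin 4 →₀ ℕ) = Finsupp.single s 1 := by
    ext j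
    simp [Finsupp.single_apply]
  simp only [KLocCellKit.evalL, List.map_cons, List.map_nil, List.sum_cons, List.sum_nil, add_zero, Int.cast_one, h]
  rfl

/-- Term list of a Laurent-graph binomial: `evalL [(1, μ + e_r), (1, 0)] = y^μ·y_r + 1`. [folklore] -/
theorem evalL_binomial (r : Fin 4) (μ : Fin 4 → ℕ) :
    KLocCellKit.evalL k [((1 : ℤ), μ + Pi.single r 1), ((1 : ℤ), (0 : Fin 4 → ℕ))] =
      monomial (Finsupp.equivFunOnFinite.symm μ) (1 : k) * X r + 1 := by
  have h1 : (Finsupp.equivFunOnFinite.symm (μ + Pi.single r 1) : Fin 4 →₀ ℕ) =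
      Finsupp.equivFunOnFinite.symm μ + Finsupp.single r 1 := by
    ext j
    simp [Finsupp.single_apply, Pi.single_apply, eq_comm]
  have h0 : (Finsupp.equivFunOnFinite.symm (0 : Fin 4 → ℕ) : Fin 4 →₀ ℕ) = 0 := by
    ext j
    simp
  have h2 : (monomial (0 : Fin 4 →₀ ℕ) (1 : k) : MvPolynomial (Fin 4) k) = 1 := C_1
  simp only [KLocCellKit.evalL, List.map_cons, List.map_nil, List.sum_cons, List.sum_nil, add_zero, Int.cast_one, h1, h0, h2, X,
    monomial_mul, mul_one]

/-- **`Σᵢ (cofactorᵢ · generatorᵢ)` as ONE term list**: the value of the flat-mapped product list over `zip C H` is the sum of the products.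
[folklore] -/
theorem evalL_flatMap_zip : ∀ (C H : List (List (ℤ × (Fin 4 → ℕ)))),
    KLocCellKit.evalL k ((List.zip C H).flatMap fun p : List (ℤ × (Fin 4 → ℕ)) × List (ℤ × (Fin 4 → ℕ)) =>
        p.1.flatMap fun s : ℤ × (Fin 4 → ℕ) => p.2.map fun t : ℤ × (Fin 4 → ℕ) => (s.1 * t.1, s.2 + t.2)) =
      ((List.zip C H).map fun p : List (ℤ × (Fin 4 → ℕ)) × List (ℤ × (Fin 4 → ℕ)) =>
        KLocCellKit.evalL k p.1 * KLocCellKit.evalL k p.2).sum := by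
  intro C H
  induction (List.zip C H) with
  | nil => simp [KLocCellKit.evalL]
  | cons p P ih =>
    unfold KLocCellKit.evalL at ih ⊢
    rw [List.flatMap_cons, List.map_append, List.sum_append, ih, List.map_cons, List.sum_cons, CIPolyKit.evalL_mul]

/-- The value of `Σᵢ cofactorᵢ·generatorᵢ` lies in the span of the generators. [folklore] -/
theorem evalL_flatMap_zip_mem_span (C H : List (List (ℤ × (Fin 4 → ℕ)))) :
    KLocCellKit.evalL k ((List.zip C H).flatMap fun p : List (ℤ × (Fin 4 → ℕ)) × List (ℤ × (Fin 4 → ℕ)) =>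
        p.1.flatMap fun s : ℤ × (Fin 4 → ℕ) => p.2.map fun t : ℤ × (Fin 4 → ℕ) => (s.1 * t.1, s.2 + t.2)) ∈
      Ideal.span {x | x ∈ H.map (KLocCellKit.evalL k)} := by
  rw [evalL_flatMap_zip]
  refine list_sum_mem fun x hx => ?_
  rw [List.mem_map] at hx
  obtain ⟨p, hp, rfl⟩ := hx
  refine Ideal.mul_mem_left _ _ (Ideal.subset_span ?_)
  exact List.mem_map.mpr ⟨p.2, (List.of_mem_zip hp).2, rfl⟩

/-- **An overlap unit is `θ` of a chart monomial**: `w_c/w_c′ = θ_c′(ȳ^u)` in `R̄[I/w_c′]`, from the exponent identity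
`m c + K₁·m c′ = Σᵢ uᵢ·a c′ i` with `|u| = K₁ + 1`. [folklore] -/
theorem div_eq_theta_monomial (c c' : Fin 87) (θ : ((MvPolynomial (Fin 4) k ⧸ Ideal.span {(KLocCellKit.evalL k (T11Char7Poly.G c'))}) ≃+* ↥(blowupAlgebra (Ideal.span ((fun e : Fin 4 →₀ ℕ => Ideal.Quotient.mk (Ideal.span {f}) (monomial e (1 : k))) '' (T11Char7Fan.A : Set (Fin 4 →₀ ℕ)))) (Ideal.Quotient.mk (Ideal.span {f}) (monomial (T11Char7Fan.m c') (1 : k)))))) (hθ : (∀ q : MvPolynomial (Fin 4) k, ((θ ((Ideal.Quotient.mk (Ideal.span {(KLocCellKit.evalL k (T11Char7Poly.G c'))})) q)) : (Localization.Away (Ideal.Quotient.mk (Ideal.span {f}) (monomial (T11Char7Fan.m c') (1 : k))))) = (aeval (fun i : Fin 4 => algebraMap (MvPolynomial (Fin 4) k ⧸ Ideal.span {f}) (Localization.Away (Ideal.Quotient.mk (Ideal.span {f}) (monomial (T11Char7Fan.m c') (1 : k)))) (Ideal.Quotient.mk (Ideal.span {f}) (monomial (T11Char7Fan.a c' i)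 (1 : k))) * IsLocalization.Away.invSelf (Ideal.Quotient.mk (Ideal.span {f}) (monomial (T11Char7Fan.m c') (1 : k))))) q))
    (u : Fin 4 → ℕ) (K₁ : ℕ) (hK : ∑ i : Fin 4, u i = K₁ + 1)
    (hu : ∀ j : Fin 4, T11Char7Fan.mF c j + K₁ * T11Char7Fan.mF c' j = ∑ i : Fin 4, u i * T11Char7Fan.aF c' i j) :
    (⟨algebraMap (MvPolynomial (Fin 4) k ⧸ Ideal.span {f}) (Localization.Away (Ideal.Quotient.mk (Ideal.span {f}) (monomial (T11Char7Fan.m c') (1 : k)))) (Ideal.Quotient.mk (Ideal.span {f}) (monomial (T11Char7Fan.m c) (1 : k))) * IsLocalization.Away.invSelf (Ideal.Quotient.mk (Ideal.span {f}) (monomial (T11Char7Fan.m c') (1 : k))), div_mem_blowupAlgebra (Ideal.span ((fun e : Fin 4 →₀ ℕ => Ideal.Quotient.mk (Ideal.span {f}) (monomial e (1 : k))) '' (T11Char7Fan.A : Set (Fin 4 →₀ ℕ)))) (Ideal.Quotient.mk (Ideal.span {f}) (monomial (T11Char7Fan.m c') (1 : k))) (Ideal.subset_span ⟨T11Char7Fan.m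 c, T11Char7Fan.hmA c, rfl⟩ : (Ideal.Quotient.mk (Ideal.span {f}) (monomial (T11Char7Fan.m c) (1 : k))) ∈ (Ideal.span ((fun e : Fin 4 →₀ ℕ => Ideal.Quotient.mk (Ideal.span {f}) (monomial e (1 : k))) '' (T11Char7Fan.A : Set (Fin 4 →₀ ℕ)))))⟩ : ↥(blowupAlgebra (Ideal.span ((fun e : Fin 4 →₀ ℕ => Ideal.Quotient.mk (Ideal.span {f}) (monomial e (1 : k))) '' (T11Char7Fan.A : Set (Fin 4 →₀ ℕ)))) (Ideal.Quotient.mk (Ideal.span {f}) (monomial (T11Char7Fan.m c') (1 : k))))) =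
      θ ((Ideal.Quotient.mk (Ideal.span {(KLocCellKit.evalL k (T11Char7Poly.G c'))})) (monomial (Finsupp.equivFunOnFinite.symm u) (1 : k))) := by
  apply Subtype.ext
  rw [hθ]
  have hU : IsUnit (algebraMap (MvPolynomial (Fin 4) k ⧸ Ideal.span {f}) (Localization.Away (Ideal.Quotient.mk (Ideal.span {f}) (monomial (T11Char7Fan.m c') (1 : k)))) (Ideal.Quotient.mk (Ideal.span {f}) (monomial (T11Char7Fan.m c') (1 : k))) ^ (∑ i : Fin 4, u i)) := (IsLocalization.Away.algebraMap_isUnit _).pow _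
  refine hU.mul_left_injective ?_
  have hsum : (∑ i : Fin 4, (Finsupp.equivFunOnFinite.symm u : Fin 4 →₀ ℕ) i) = ∑ i : Fin 4, u i :=
    Finset.sum_congr rfl fun i _ => by rw [Finsupp.coe_equivFunOnFinite_symm]
  have key := ChartModelNumerators.psi_monomial_mul_pow f (T11Char7Fan.m c') (T11Char7Fan.a c') (1 : k)
    (Finsupp.equivFunOnFinite.symm u) (∑ i : Fin 4, u i) (by rw [hsum])
  simp only at key ⊢
  rw [key, hsum, Nat.sub_self, zero_smul, add_zero, hK, pow_succ', ← mul_assoc, mul_assoc (algebraMap _ _ _) (IsLocalization.Away.invSelf _),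
    mul_comm (IsLocalization.Away.invSelf _), IsLocalization.Away.mul_invSelf, mul_one, ← map_pow, ← map_mul, ← map_pow, ← map_mul,
    monomial_pow, one_pow, monomial_mul, mul_one]
  have hexp : (T11Char7Fan.m c + K₁ • T11Char7Fan.m c' : Fin 4 →₀ ℕ) =
      ∑ i : Fin 4, (Finsupp.equivFunOnFinite.symm u : Fin 4 →₀ ℕ) i • T11Char7Fan.a c' i := by
    ext j
    have h1 : ((T11Char7Fan.m c + K₁ • T11Char7Fan.m c' : Fin 4 →₀ ℕ) : Fin 4 → ℕ) j = T11Char7Fan.mF c j + K₁ * T11Char7Fan.mF c' j := by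
      simp [T11Char7Fan.m, Finsupp.coe_equivFunOnFinite_symm]
    have h2 : ((∑ i : Fin 4, (Finsupp.equivFunOnFinite.symm u : Fin 4 →₀ ℕ) i • T11Char7Fan.a c' i : Fin 4 →₀ ℕ) : Fin 4 → ℕ) j =
        ∑ i : Fin 4, u i * T11Char7Fan.aF c' i j := by
      simp [T11Char7Fan.a, Finsupp.coe_equivFunOnFinite_symm, Finsupp.finsetSum_apply]
    rw [h1, h2, hu j]
  rw [hexp]


/-! ## §2 The generic chart theorem, assembled from small dictionary lemmas -/

section Main

/-- Membership in a list of length three is being one of the three `getD` entries. [folklore] -/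
theorem mem_iff_getD_of_length {α : Type} (l : List α) (d : α) (hl : l.length = 3) (x : α) :
    x ∈ l ↔ ∃ i : Fin 3, x = l.getD i d := by
  constructor
  · intro hx
    obtain ⟨n, hn, rfl⟩ := List.getElem_of_mem hx
    refine ⟨⟨n, by rw [← hl]; exact hn⟩, ?_⟩
    rw [List.getD_eq_getElem _ _ hn]
  · rintro ⟨i, rfl⟩
    have hi : (i : ℕ) < l.length := by rw [hl]; exact i.2
    rw [List.getD_eq_getElem _ _ hi]
    exact List.getElem_mem hi

/-- The numerator relation on the RAW exponent tables `T11Char7Fan.aF`, `T11Char7Fan.mF` (decidable on literals) gives the relation on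
the `Finsupp` tables `T11Char7Fan.a`, `T11Char7Fan.m` consumed by `ChartModelNumerators`. [folklore] -/
theorem forall₂_rel_of_raw (C : Fin 87) (K : ℕ) (L NL : List (ℤ × (Fin 4 → ℕ)))
    (h : List.Forall₂ (fun t s : ℤ × (Fin 4 → ℕ) => s.1 = t.1 ∧ (∑ ii : Fin 4, t.2 ii) ≤ K ∧ ∀ jj : Fin 4, s.2 jj = (∑ ii : Fin 4, t.2 ii * T11Char7Fan.aF C ii jj) + (K - ∑ ii : Fin 4, t.2 ii) * T11Char7Fan.mF C jj) L NL) :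
    List.Forall₂ (fun t s : ℤ × (Fin 4 → ℕ) => s.1 = t.1 ∧ (∑ i : Fin 4, t.2 i) ≤ K ∧
      ∀ j : Fin 4, s.2 j = (∑ i : Fin 4, t.2 i * T11Char7Fan.a C i j) + (K - ∑ i : Fin 4, t.2 i) * T11Char7Fan.m C j) L NL := by
  refine h.imp fun t s hts => ⟨hts.1, hts.2.1, fun j => ?_⟩
  rw [hts.2.2 j]
  rfl

/-- The GENERAL (subtraction-free) numerator relation `Σᵢ eᵢ·(aᵢ)ⱼ + K·mⱼ = βⱼ + |e|·mⱼ` on the raw tables gives the one on the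
`Finsupp` tables consumed by `ChartModelReadings` (cross-chart readings have `|e| > K`). [folklore] -/
theorem forall₂_relgen_of_raw (C : Fin 87) (K : ℕ) (L NL : List (ℤ × (Fin 4 → ℕ)))
    (h : List.Forall₂ (fun t s : ℤ × (Fin 4 → ℕ) => s.1 = t.1 ∧ ∀ jj : Fin 4, (∑ ii : Fin 4, t.2 ii * T11Char7Fan.aF C ii jj) + K * T11Char7Fan.mF C jj = s.2 jj + (∑ ii : Fin 4, t.2 ii) * T11Char7Fan.mF C jj) L NL) :
    List.Forall₂ (fun t s : ℤ × (Fin 4 → ℕ) => s.1 = t.1 ∧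
      ∀ j : Fin 4, (∑ i : Fin 4, t.2 i * T11Char7Fan.a C i j) + K * T11Char7Fan.m C j = s.2 j + (∑ i : Fin 4, t.2 i) * T11Char7Fan.m C j)
      L NL := by
  refine h.imp fun t s hts => ⟨hts.1, fun j => ?_⟩
  exact hts.2 j

/-- The generator polynomials of a chart whose list `HS c` has the LAURENT-GRAPH SHAPE `[y_s (s ∈ S)] ++ [y^μ·y_r + 1]` up to order
(`r ∉ S`, `y^μ` prime to `y_S`, `y_r`): as a set, `{y_s | s ∈ S} ∪ {y^μ·y_r + 1}`. [folklore] -/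
theorem setOf_mem_HS_eq (c : Fin 87) (Sl : List (Fin 4)) (r : Fin 4) (μ : Fin 4 → ℕ)
    (hperm : (T11Char3Poly.HS c).Perm (((Sl).map fun s : Fin 4 => [((1 : ℤ), (Pi.single s 1 : Fin 4 → ℕ))]) ++ [[((1 : ℤ), μ + Pi.single r 1), ((1 : ℤ), (0 : Fin 4 → ℕ))]])) :
    {x | x ∈ (T11Char3Poly.HS c).map (KLocCellKit.evalL k)} =
      ((fun s : Fin 4 => (X s : MvPolynomial (Fin 4) k)) '' ((Sl.toFinset : Finset (Fin 4)) : Set (Fin 4))) ∪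
        {monomial (Finsupp.equivFunOnFinite.symm μ) (1 : k) * X r + 1} := by
  ext x
  simp only [Set.mem_setOf_eq, Set.mem_union, Set.mem_image, Set.mem_singleton_iff, Finset.mem_coe, List.mem_toFinset]
  rw [List.mem_map, show (∃ a, a ∈ T11Char3Poly.HS c ∧ KLocCellKit.evalL k a = x) ↔
    ∃ a, a ∈ (((Sl).map fun s : Fin 4 => [((1 : ℤ), (Pi.single s 1 : Fin 4 → ℕ))]) ++ [[((1 : ℤ), μ + Pi.single r 1), ((1 : ℤ), (0 : Fin 4 → ℕ))]]) ∧ KLocCellKit.evalL k a = x from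
      exists_congr fun a => by rw [hperm.mem_iff]]
  simp only [List.mem_append, List.mem_map, List.mem_singleton]
  constructor
  · rintro ⟨a, (⟨s, hs, rfl⟩ | rfl), rfl⟩
    · exact Or.inl ⟨s, hs, (evalL_single k s).symm⟩
    · exact Or.inr (evalL_binomial k r μ)
  · rintro (⟨s, hs, rfl⟩ | rfl)
    · exact ⟨_, Or.inl ⟨s, hs, rfl⟩, evalL_single k s⟩
    · exact ⟨_, Or.inr rfl, evalL_binomial k r μ⟩

/-- … hence the ideal `(HS c)` of `k[y]` is PRIME (`ChartModelNumerators.isPrime_span_laurentGraph`). [folklore] -/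
theorem isPrime_span_HS (c : Fin 87) (Sl : List (Fin 4)) (r : Fin 4) (μ : Fin 4 → ℕ) (hrS : r ∉ Sl)
    (hμS : ∀ s ∈ Sl, μ s = 0) (hμr : μ r = 0) (hperm : (T11Char3Poly.HS c).Perm (((Sl).map fun s : Fin 4 => [((1 : ℤ), (Pi.single s 1 : Fin 4 → ℕ))]) ++ [[((1 : ℤ), μ + Pi.single r 1), ((1 : ℤ), (0 : Fin 4 → ℕ))]])) :
    (Ideal.span {x | x ∈ (T11Char3Poly.HS c).map (KLocCellKit.evalL k)}).IsPrime := by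
  rw [setOf_mem_HS_eq k c Sl r μ hperm]
  exact ChartModelNumerators.isPrime_span_laurentGraph (k := k) Sl.toFinset r (Finsupp.equivFunOnFinite.symm μ)
    (by rwa [List.mem_toFinset]) (fun s hs => by rw [Finsupp.coe_equivFunOnFinite_symm]; exact hμS s (List.mem_toFinset.mp hs))
    (by rw [Finsupp.coe_equivFunOnFinite_symm]; exact hμr)

/-- … and a coefficient-one monomial OFF the variables `y_s (s ∈ S)` is not in `(HS c)`
(`ChartModelNumerators.not_mem_span_laurentGraph_of_monomial`). [folklore] -/
theorem monomial_not_mem_span_HS (c : Fin 87) (Sl : List (Fin 4)) (r : Fin 4) (μ : Fin 4 → ℕ) (hrS : r ∉ Sl)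
    (hμS : ∀ s ∈ Sl, μ s = 0) (hμr : μ r = 0) (hperm : (T11Char3Poly.HS c).Perm (((Sl).map fun s : Fin 4 => [((1 : ℤ), (Pi.single s 1 : Fin 4 → ℕ))]) ++ [[((1 : ℤ), μ + Pi.single r 1), ((1 : ℤ), (0 : Fin 4 → ℕ))]]))
    (ν : Fin 4 → ℕ) (hν : ∀ s ∈ Sl, ν s = 0) :
    (monomial (Finsupp.equivFunOnFinite.symm ν) (1 : k) : MvPolynomial (Fin 4) k) ∉ Ideal.span {x | x ∈ (T11Char3Poly.HS c).map (KLocCellKit.evalL k)} := by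
  rw [setOf_mem_HS_eq k c Sl r μ hperm]
  exact ChartModelNumerators.not_mem_span_laurentGraph_of_monomial (k := k) Sl.toFinset r (Finsupp.equivFunOnFinite.symm μ)
    (by rwa [List.mem_toFinset]) (fun s hs => by rw [Finsupp.coe_equivFunOnFinite_symm]; exact hμS s (List.mem_toFinset.mp hs))
    (by rw [Finsupp.coe_equivFunOnFinite_symm]; exact hμr) (Finsupp.equivFunOnFinite.symm ν)
    (fun s hs => by rw [Finsupp.coe_equivFunOnFinite_symm]; exact hν s (List.mem_toFinset.mp hs)) one_ne_zero

/-- **`g_c ∈ (HS c)`** from a COFACTOR CERTIFICATE modulo `3`: cofactor term lists `GC` with `G c ≡ Σ GCᵢ·(HS c)ᵢ` coefficientwise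
mod `3` (`CIPolyKit.evalL_eq_of_coeff_congr`, decidable on literals). [folklore] -/
theorem evalL_G_mem_span_HS [CharP k 3] (c : Fin 87) (GC : List (List (ℤ × (Fin 4 → ℕ))))
    (hG : ∀ v ∈ (T11Char7Poly.G c).map (fun t : ℤ × (Fin 4 → ℕ) => t.2) ++
        ((List.zip GC (T11Char3Poly.HS c)).flatMap fun p : List (ℤ × (Fin 4 → ℕ)) × List (ℤ × (Fin 4 → ℕ)) =>
          p.1.flatMap fun s : ℤ × (Fin 4 → ℕ) => p.2.map fun t : ℤ × (Fin 4 → ℕ) => (s.1 * t.1, s.2 + t.2)).map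
          (fun t : ℤ × (Fin 4 → ℕ) => t.2),
      (3 : ℤ) ∣ (((T11Char7Poly.G c).filter fun t : ℤ × (Fin 4 → ℕ) => t.2 = v).map (fun t : ℤ × (Fin 4 → ℕ) => t.1)).sum -
        ((((List.zip GC (T11Char3Poly.HS c)).flatMap fun p : List (ℤ × (Fin 4 → ℕ)) × List (ℤ × (Fin 4 → ℕ)) =>
          p.1.flatMap fun s : ℤ × (Fin 4 → ℕ) => p.2.map fun t : ℤ × (Fin 4 → ℕ) => (s.1 * t.1, s.2 + t.2)).filter
          fun t : ℤ × (Fin 4 → ℕ) => t.2 = v).map (fun t : ℤ × (Fin 4 → ℕ) => t.1)).sum) :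
    KLocCellKit.evalL k (T11Char7Poly.G c) ∈ Ideal.span {x | x ∈ (T11Char3Poly.HS c).map (KLocCellKit.evalL k)} := by
  have heq := CIPolyKit.evalL_eq_of_coeff_congr (K := k) 3 (T11Char7Poly.G c) _ hG
  have heq' : KLocCellKit.evalL k (T11Char7Poly.G c) = KLocCellKit.evalL k
      ((List.zip GC (T11Char3Poly.HS c)).flatMap fun p : List (ℤ × (Fin 4 → ℕ)) × List (ℤ × (Fin 4 → ℕ)) =>
        p.1.flatMap fun s : ℤ × (Fin 4 → ℕ) => p.2.map fun t : ℤ × (Fin 4 → ℕ) => (s.1 * t.1, s.2 + t.2)) := heq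
  rw [heq']
  exact evalL_flatMap_zip_mem_span k GC (T11Char3Poly.HS c)

/-- Membership in the model ideal `I₂ c = (HS c)·(k[y]/(g_c))` pulls back to membership in `(HS c) ⊆ k[y]` once `g_c ∈ (HS c)`. [folklore] -/
theorem mem_span_HS_of_mk_mem (c : Fin 87) (hgc : KLocCellKit.evalL k (T11Char7Poly.G c) ∈ Ideal.span {x | x ∈ (T11Char3Poly.HS c).map (KLocCellKit.evalL k)})
    (q : MvPolynomial (Fin 4) k) (hq : (Ideal.Quotient.mk (Ideal.span {(KLocCellKit.evalL k (T11Char7Poly.G c))})) q ∈ ((Ideal.span {x | x ∈ (T11Char3Poly.HS c).map (KLocCellKit.evalL k)}).map (Ideal.Quotient.mk (Ideal.span {(KLocCellKit.evalL k (T11Char7Poly.G c))})))) : q ∈ Ideal.span {x | x ∈ (T11Char3Poly.HS c).map (KLocCellKit.evalL k)} := by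
  rw [Ideal.mem_map_iff_of_surjective _ Ideal.Quotient.mk_surjective] at hq
  obtain ⟨q', hq', hqq⟩ := hq
  rw [Ideal.Quotient.eq] at hqq
  have : q = q' - (q' - q) := by ring
  rw [this]
  exact Ideal.sub_mem _ hq' ((Ideal.span_singleton_le_iff_mem _).mpr hgc hqq)

/-- The model ideal `I₂ c` is PRIME (image of the prime `(HS c) ⊇ ker` under the quotient map). [folklore] -/
theorem isPrime_I₂ (c : Fin 87) (hprime : (Ideal.span {x | x ∈ (T11Char3Poly.HS c).map (KLocCellKit.evalL k)}).IsPrime)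
    (hgc : KLocCellKit.evalL k (T11Char7Poly.G c) ∈ Ideal.span {x | x ∈ (T11Char3Poly.HS c).map (KLocCellKit.evalL k)}) : (((Ideal.span {x | x ∈ (T11Char3Poly.HS c).map (KLocCellKit.evalL k)}).map (Ideal.Quotient.mk (Ideal.span {(KLocCellKit.evalL k (T11Char7Poly.G c))})))).IsPrime := by
  refine Ideal.map_isPrime_of_surjective Ideal.Quotient.mk_surjective ?_
  rw [Ideal.mk_ker, Ideal.span_singleton_le_iff_mem]
  exact hgc

/-- **Units stay units**: the `θ_c`-image of a coefficient-one monomial off `y_S` is NOT in `(I₂ c)·θ_c`. [folklore] -/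
theorem theta_monomial_not_mem (c : Fin 87) (Sl : List (Fin 4)) (r : Fin 4) (μ : Fin 4 → ℕ) (hrS : r ∉ Sl)
    (hμS : ∀ s ∈ Sl, μ s = 0) (hμr : μ r = 0) (hperm : (T11Char3Poly.HS c).Perm (((Sl).map fun s : Fin 4 => [((1 : ℤ), (Pi.single s 1 : Fin 4 → ℕ))]) ++ [[((1 : ℤ), μ + Pi.single r 1), ((1 : ℤ), (0 : Fin 4 → ℕ))]]))
    (hgc : KLocCellKit.evalL k (T11Char7Poly.G c) ∈ Ideal.span {x | x ∈ (T11Char3Poly.HS c).map (KLocCellKit.evalL k)})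
    (θ : ((MvPolynomial (Fin 4) k ⧸ Ideal.span {(KLocCellKit.evalL k (T11Char7Poly.G c))}) ≃+* ↥(blowupAlgebra (Ideal.span ((fun e : Fin 4 →₀ ℕ => Ideal.Quotient.mk (Ideal.span {f}) (monomial e (1 : k))) '' (T11Char7Fan.A : Set (Fin 4 →₀ ℕ)))) (Ideal.Quotient.mk (Ideal.span {f}) (monomial (T11Char7Fan.m c) (1 : k)))))) (ν : Fin 4 → ℕ) (hν : ∀ s ∈ Sl, ν s = 0) :
    θ ((Ideal.Quotient.mk (Ideal.span {(KLocCellKit.evalL k (T11Char7Poly.G c))})) (monomial (Finsupp.equivFunOnFinite.symm ν) (1 : k))) ∉ (((Ideal.span {x | x ∈ (T11Char3Poly.HS c).map (KLocCellKit.evalL k)}).map (Ideal.Quotient.mk (Ideal.span {(KLocCellKit.evalL k (T11Char7Poly.G c))})))).map θ := by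
  rw [Ideal.apply_mem_of_equiv_iff]
  exact fun hmem => monomial_not_mem_span_HS k c Sl r μ hrS hμS hμr hperm ν hν (mem_span_HS_of_mk_mem k c hgc _ hmem)

/-- **`(I₂ c)·θ_c ≤ ⟨numerator forms⟩`**: with the numerator table `N` of the three generators of `HS c` (heights `(N i).1`,
numerators `(N i).2` — `ChartModelNumerators.theta_mk_evalL_eq_reesChartEquiv`), the model ideal read in `R̄[I/w_c]` lies in the span
of the three numerator forms `x_i/(w_c t)^{n_i}` — the `hQa`/`hP` guards of `AffineBlowupChartRestriction.map_ideal_closure_eq_of_memberships`.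
[folklore] -/
theorem map_I₂_le_span_numerators (c : Fin 87) (θ : ((MvPolynomial (Fin 4) k ⧸ Ideal.span {(KLocCellKit.evalL k (T11Char7Poly.G c))}) ≃+* ↥(blowupAlgebra (Ideal.span ((fun e : Fin 4 →₀ ℕ => Ideal.Quotient.mk (Ideal.span {f}) (monomial e (1 : k))) '' (T11Char7Fan.A : Set (Fin 4 →₀ ℕ)))) (Ideal.Quotient.mk (Ideal.span {f}) (monomial (T11Char7Fan.m c) (1 : k)))))) (hθ : (∀ q : MvPolynomial (Fin 4) k, ((θ ((Ideal.Quotient.mk (Ideal.span {(KLocCellKit.evalL k (T11Char7Poly.G c))})) q)) : (Localization.Away (Ideal.Quotient.mk (Ideal.span {f}) (monomial (T11Char7Fan.m c) (1 : k))))) = (aeval (fun i : Fin 4 => algebraMap (MvPolynomial (Fin 4) k ⧸ Ideal.span {f}) (Localization.Away (Ideal.Quotient.mk (Ideal.span {f}) (monomial (T11Char7Fan.m c) (1 : k)))) (Ideal.Quotient.mk (Ideal.span {f}) (monomial (T11Char7Fan.a c i) (1 : k))) * IsLocalization.Away.invSelf (Ideal.Quotient.mk (Ideal.span {f}) (monomial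 (T11Char7Fan.m c) (1 : k))))) q)) (hlen : (T11Char3Poly.HS c).length = 3)
    (N : Fin 3 → ℕ × List (ℤ × (Fin 4 → ℕ)))
    (hN : ∀ i : Fin 3, List.Forall₂ (fun t s : ℤ × (Fin 4 → ℕ) => s.1 = t.1 ∧ (∑ ii : Fin 4, t.2 ii) ≤ (N i).1 ∧ ∀ jj : Fin 4, s.2 jj = (∑ ii : Fin 4, t.2 ii * T11Char7Fan.aF c ii jj) + ((N i).1 - ∑ ii : Fin 4, t.2 ii) * T11Char7Fan.mF c jj) ((T11Char3Poly.HS c).getD i []) (N i).2) :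
    (((Ideal.span {x | x ∈ (T11Char3Poly.HS c).map (KLocCellKit.evalL k)}).map (Ideal.Quotient.mk (Ideal.span {(KLocCellKit.evalL k (T11Char7Poly.G c))})))).map θ ≤ Ideal.span (Set.range fun i : Fin 3 =>
      reesChartEquiv (Ideal.Quotient.mk (Ideal.span {f}) (monomial (T11Char7Fan.m c) (1 : k))) (Ideal.subset_span ⟨T11Char7Fan.m c, T11Char7Fan.hmA c, rfl⟩ : (Ideal.Quotient.mk (Ideal.span {f}) (monomial (T11Char7Fan.m c) (1 : k))) ∈ (Ideal.span ((fun e : Fin 4 →₀ ℕ => Ideal.Quotient.mk (Ideal.span {f}) (monomial e (1 : k))) '' (T11Char7Fan.A : Set (Fin 4 →₀ ℕ))))) (HomogeneousLocalization.Away.mk (reesGrading (Ideal.span ((fun e : Fin 4 →₀ ℕ => Ideal.Quotient.mk (Ideal.span {f}) (monomial e (1 : k))) '' (T11Char7Fan.A : Set (Fin 4 →₀ ℕ))))) (reesT_mem (Ideal.Quotient.mk (Ideal.span {f}) (monomial (T11Char7Fan.m c) (1 : k))) (Ideal.subset_span ⟨T11Char7Fan.m c, T11Char7Fan.hmA c,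 rfl⟩ : (Ideal.Quotient.mk (Ideal.span {f}) (monomial (T11Char7Fan.m c) (1 : k))) ∈ (Ideal.span ((fun e : Fin 4 →₀ ℕ => Ideal.Quotient.mk (Ideal.span {f}) (monomial e (1 : k))) '' (T11Char7Fan.A : Set (Fin 4 →₀ ℕ)))))) (N i).1 ⟨Polynomial.monomial (N i).1 (Ideal.Quotient.mk (Ideal.span {f}) (KLocCellKit.evalL k (N i).2)), reesAlgebra.monomial_mem.mpr (ChartModelNumerators.mk_evalL_mem_pow f (T11Char7Fan.m c) (T11Char7Fan.a c) T11Char7Fan.A (T11Char7Fan.haA c) (T11Char7Fan.hmA c) (N i).1 ((T11Char3Poly.HS c).getD i []) (N i).2 (forall₂_rel_of_raw c (N i).1 _ _ (hN i)))⟩ ⟨Ideal.Quotient.mk (Ideal.span {f}) (KLocCellKit.evalL k (N i).2), by simp⟩)) := by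
  rw [map_I₂_eq_span]
  refine Ideal.span_le.mpr ?_
  rintro _ ⟨L, hL, rfl⟩
  obtain ⟨i, rfl⟩ := (mem_iff_getD_of_length _ [] hlen L).mp hL
  dsimp only
  have hnum : θ ((Ideal.Quotient.mk (Ideal.span {(KLocCellKit.evalL k (T11Char7Poly.G c))})) (KLocCellKit.evalL k ((T11Char3Poly.HS c).getD i []))) = _ :=
    ChartModelNumerators.theta_mk_evalL_eq_reesChartEquiv f (T11Char7Fan.m c) (T11Char7Fan.a c) T11Char7Fan.A (T11Char7Fan.haA c)
      (T11Char7Fan.hmA c) _ θ.toRingHom (fun q => hθ q) (Ideal.subset_span ⟨T11Char7Fan.m c, T11Char7Fan.hmA c, rfl⟩ : (Ideal.Quotient.mk (Ideal.span {f}) (monomial (T11Char7Fan.m c) (1 : k))) ∈ (Ideal.span ((fun e : Fin 4 →₀ ℕ => Ideal.Quotient.mk (Ideal.span {f}) (monomial e (1 : k))) '' (T11Char7Fan.A : Set (Fin 4 →₀ ℕ))))) (N i).1 ((T11Char3Poly.HS c).getD i []) (N i).2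
      (forall₂_rel_of_raw c (N i).1 _ _ (hN i))
  rw [hnum]
  exact Ideal.subset_span ⟨i, rfl⟩

/-- **Readings land in the model ideal**: a numerator form `x/(w_c t)^K` (`x = mk (evalL NL) ∈ I^K`, e.g. a generator of the
OTHER chart's model ideal) whose chart-`c` reading — under the GENERAL relation of `ChartModelReadings` — is a ONE-MONOMIAL multiple
`co·(HS c)_idx` of a generator (term list possibly REVERSED, `rev`) lies in `(I₂ c)·θ_c`: the `h1`/`h2` guards. [folklore] -/
theorem numerator_mem_map_I₂ (c : Fin 87) (θ : ((MvPolynomial (Fin 4) k ⧸ Ideal.span {(KLocCellKit.evalL k (T11Char7Poly.G c))}) ≃+* ↥(blowupAlgebra (Ideal.span ((fun e : Fin 4 →₀ ℕ => Ideal.Quotient.mk (Ideal.span {f}) (monomial e (1 : k))) '' (T11Char7Fan.A : Set (Fin 4 →₀ ℕ)))) (Ideal.Quotient.mk (Ideal.span {f}) (monomial (T11Char7Fan.m c) (1 : k)))))) (hθ : (∀ q : MvPolynomial (Fin 4) k, ((θ ((Ideal.Quotient.mk (Ideal.span {(KLocCellKit.evalL k (T11Char7Poly.G c))})) q)) : (Localization.Away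 (Ideal.Quotient.mk (Ideal.span {f}) (monomial (T11Char7Fan.m c) (1 : k))))) = (aeval (fun i : Fin 4 => algebraMap (MvPolynomial (Fin 4) k ⧸ Ideal.span {f}) (Localization.Away (Ideal.Quotient.mk (Ideal.span {f}) (monomial (T11Char7Fan.m c) (1 : k)))) (Ideal.Quotient.mk (Ideal.span {f}) (monomial (T11Char7Fan.a c i) (1 : k))) * IsLocalization.Away.invSelf (Ideal.Quotient.mk (Ideal.span {f}) (monomial (T11Char7Fan.m c) (1 : k))))) q)) (hlen : (T11Char3Poly.HS c).length = 3)
    (idx : ℕ) (hidx : idx < 3) (rev : Bool) (co : ℤ × (Fin 4 → ℕ)) (K : ℕ) (NL : List (ℤ × (Fin 4 → ℕ)))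
    (hmem : Ideal.Quotient.mk (Ideal.span {f}) (KLocCellKit.evalL k NL) ∈ ((Ideal.span ((fun e : Fin 4 →₀ ℕ => Ideal.Quotient.mk (Ideal.span {f}) (monomial e (1 : k))) '' (T11Char7Fan.A : Set (Fin 4 →₀ ℕ))))) ^ K)
    (hR : List.Forall₂ (fun t s : ℤ × (Fin 4 → ℕ) => s.1 = t.1 ∧ ∀ jj : Fin 4, (∑ ii : Fin 4, t.2 ii * T11Char7Fan.aF c ii jj) + K * T11Char7Fan.mF c jj = s.2 jj + (∑ ii : Fin 4, t.2 ii) * T11Char7Fan.mF c jj) (bif rev then (((T11Char3Poly.HS c).getD idx []).map fun t : ℤ × (Fin 4 → ℕ) => ((co).1 * t.1, (co).2 + t.2)).reverse else (((T11Char3Poly.HS c).getD idx []).map fun t : ℤ × (Fin 4 → ℕ) => ((co).1 * t.1, (co).2 + t.2))) NL) :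
    reesChartEquiv (Ideal.Quotient.mk (Ideal.span {f}) (monomial (T11Char7Fan.m c) (1 : k))) (Ideal.subset_span ⟨T11Char7Fan.m c, T11Char7Fan.hmA c, rfl⟩ : (Ideal.Quotient.mk (Ideal.span {f}) (monomial (T11Char7Fan.m c) (1 : k))) ∈ (Ideal.span ((fun e : Fin 4 →₀ ℕ => Ideal.Quotient.mk (Ideal.span {f}) (monomial e (1 : k))) '' (T11Char7Fan.A : Set (Fin 4 →₀ ℕ))))) (HomogeneousLocalization.Away.mk (reesGrading (Ideal.span ((fun e : Fin 4 →₀ ℕ => Ideal.Quotient.mk (Ideal.span {f}) (monomial e (1 : k))) '' (T11Char7Fan.A : Set (Fin 4 →₀ ℕ))))) (reesT_mem (Ideal.Quotient.mk (Ideal.span {f}) (monomial (T11Char7Fan.m c) (1 : k))) (Ideal.subset_span ⟨T11Char7Fan.m c, T11Char7Fan.hmA c, rfl⟩ : (Ideal.Quotient.mk (Ideal.span {f}) (monomial (T11Char7Fan.m c) (1 : k))) ∈ (Ideal.span ((fun e : Fin 4 →₀ ℕ => Ideal.Quotient.mk (Ideal.span {f}) (monomial e (1 : k))) '' (T11Char7Fan.A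 : Set (Fin 4 →₀ ℕ)))))) K ⟨Polynomial.monomial K (Ideal.Quotient.mk (Ideal.span {f}) (KLocCellKit.evalL k NL)), reesAlgebra.monomial_mem.mpr hmem⟩ ⟨Ideal.Quotient.mk (Ideal.span {f}) (KLocCellKit.evalL k NL), by simp⟩) ∈ (((Ideal.span {x | x ∈ (T11Char3Poly.HS c).map (KLocCellKit.evalL k)}).map (Ideal.Quotient.mk (Ideal.span {(KLocCellKit.evalL k (T11Char7Poly.G c))})))).map θ := by
  have hnum : θ ((Ideal.Quotient.mk (Ideal.span {(KLocCellKit.evalL k (T11Char7Poly.G c))})) (KLocCellKit.evalL k (bif rev then (((T11Char3Poly.HS c).getD idx []).map fun t : ℤ × (Fin 4 → ℕ) => ((co).1 * t.1, (co).2 + t.2)).reverse else (((T11Char3Poly.HS c).getD idx []).map fun t : ℤ × (Fin 4 → ℕ) => ((co).1 * t.1, (co).2 + t.2))))) = _ :=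
    ChartModelReadings.theta_mk_evalL_eq_reesChartEquiv_of_rel f (T11Char7Fan.m c) (T11Char7Fan.a c) _ (Ideal.subset_span ⟨T11Char7Fan.m c, T11Char7Fan.hmA c, rfl⟩ : (Ideal.Quotient.mk (Ideal.span {f}) (monomial (T11Char7Fan.m c) (1 : k))) ∈ (Ideal.span ((fun e : Fin 4 →₀ ℕ => Ideal.Quotient.mk (Ideal.span {f}) (monomial e (1 : k))) '' (T11Char7Fan.A : Set (Fin 4 →₀ ℕ))))) _ θ.toRingHom
      (fun q => hθ q) K _ NL hmem (forall₂_relgen_of_raw c K _ _ hR)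
  have h0 : KLocCellKit.evalL k (((T11Char3Poly.HS c).getD idx []).map fun t : ℤ × (Fin 4 → ℕ) => ((co).1 * t.1, (co).2 + t.2)) =
      monomial (Finsupp.equivFunOnFinite.symm co.2) ((co.1 : ℤ) : k) * KLocCellKit.evalL k ((T11Char3Poly.HS c).getD idx []) :=
    (CIPolyKit.monomial_mul_evalL (K := k) co.1 co.2 _).symm
  have hmul : KLocCellKit.evalL k (bif rev then (((T11Char3Poly.HS c).getD idx []).map fun t : ℤ × (Fin 4 → ℕ) => ((co).1 * t.1, (co).2 + t.2)).reverse else (((T11Char3Poly.HS c).getD idx []).map fun t : ℤ × (Fin 4 → ℕ) => ((co).1 * t.1, (co).2 + t.2))) =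
      monomial (Finsupp.equivFunOnFinite.symm co.2) ((co.1 : ℤ) : k) * KLocCellKit.evalL k ((T11Char3Poly.HS c).getD idx []) := by
    cases rev
    · exact h0
    · rw [← h0]; simp only [cond_true]; unfold KLocCellKit.evalL; rw [List.map_reverse, List.sum_reverse]
  rw [← hnum, hmul, RingHom.map_mul, map_mul θ, map_I₂_eq_span]
  refine Ideal.mul_mem_left _ _ (Ideal.subset_span ⟨(T11Char3Poly.HS c).getD idx [], ?_, rfl⟩)
  exact (mem_iff_getD_of_length _ [] hlen _).mpr ⟨⟨idx, hidx⟩, rfl⟩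

/-- **THE GENERIC CHART THEOREM OF THE R3 DATA HALF.** From the literal certificate data of a chart `c` meeting the bad curve —
numerator tables of the generators of `HS 64` and `HS c`, the Laurent-graph shape of `HS c`, the cofactor certificate `g_c ∈ (HS c)`
mod `3` (and `g₆₄ ∈ (HS 64)`), the one-monomial-cofactor readings in both directions, the two overlap-unit exponent identities; every
hypothesis `decide`-able on literals — the curve's ideal on the chart, read in `R̄[I/w_c]`, IS the model ideal:
`ξ ∈ U c` and `(𝓘(closure {ξ}).ideal (U c))·e_c = (I₂ c)·θ_c`. [folklore] -/
theorem ideal_closure_map_eq_of_data [CharP k 3] (c : Fin 87)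
    (e64 : (Γ(affineBlowup (Ideal.span ((fun e : Fin 4 →₀ ℕ => Ideal.Quotient.mk (Ideal.span {f}) (monomial e (1 : k))) '' (T11Char7Fan.A : Set (Fin 4 →₀ ℕ)))), (Proj.basicOpen (reesGrading (Ideal.span ((fun e : Fin 4 →₀ ℕ => Ideal.Quotient.mk (Ideal.span {f}) (monomial e (1 : k))) '' (T11Char7Fan.A : Set (Fin 4 →₀ ℕ))))) (reesT (I := (Ideal.span ((fun e : Fin 4 →₀ ℕ => Ideal.Quotient.mk (Ideal.span {f}) (monomial e (1 : k))) '' (T11Char7Fan.A : Set (Fin 4 →₀ ℕ))))) (Ideal.Quotient.mk (Ideal.span {f}) (monomial (T11Char7Fan.m 64) (1 : k))) (Ideal.subset_span ⟨T11Char7Fan.m 64, T11Char7Fan.hmA 64, rfl⟩ : (Ideal.Quotient.mk (Ideal.span {f}) (monomial (T11Char7Fan.m 64) (1 : k))) ∈ (Ideal.span ((fun e : Fin 4 →₀ ℕ => Ideal.Quotient.mk (Ideal.span {f}) (monomial e (1 : k))) '' (T11Char7Fan.A : Set (Fin 4 →₀ ℕ)))))))) ≃+* ↥(blowupAlgebra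 (Ideal.span ((fun e : Fin 4 →₀ ℕ => Ideal.Quotient.mk (Ideal.span {f}) (monomial e (1 : k))) '' (T11Char7Fan.A : Set (Fin 4 →₀ ℕ)))) (Ideal.Quotient.mk (Ideal.span {f}) (monomial (T11Char7Fan.m 64) (1 : k)))))) (hea64 : (∀ g : HomogeneousLocalization.Away (reesGrading (Ideal.span ((fun e : Fin 4 →₀ ℕ => Ideal.Quotient.mk (Ideal.span {f}) (monomial e (1 : k))) '' (T11Char7Fan.A : Set (Fin 4 →₀ ℕ))))) (reesT (I := (Ideal.span ((fun e : Fin 4 →₀ ℕ => Ideal.Quotient.mk (Ideal.span {f}) (monomial e (1 : k))) '' (T11Char7Fan.A : Set (Fin 4 →₀ ℕ))))) (Ideal.Quotient.mk (Ideal.span {f}) (monomial (T11Char7Fan.m 64) (1 : k))) (Ideal.subset_span ⟨T11Char7Fan.m 64, T11Char7Fan.hmA 64, rfl⟩ : (Ideal.Quotient.mk (Ideal.span {f}) (monomial (T11Char7Fan.m 64) (1 : k))) ∈ (Ideal.span ((fun e : Fin 4 →₀ ℕ => Ideal.Quotient.mk (Ideal.span {f}) (monomial e (1 : k))) '' (T11Char7Fan.A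 : Set (Fin 4 →₀ ℕ)))))), e64 ((Proj.basicOpenIsoAway (reesGrading (Ideal.span ((fun e : Fin 4 →₀ ℕ => Ideal.Quotient.mk (Ideal.span {f}) (monomial e (1 : k))) '' (T11Char7Fan.A : Set (Fin 4 →₀ ℕ))))) (reesT (I := (Ideal.span ((fun e : Fin 4 →₀ ℕ => Ideal.Quotient.mk (Ideal.span {f}) (monomial e (1 : k))) '' (T11Char7Fan.A : Set (Fin 4 →₀ ℕ))))) (Ideal.Quotient.mk (Ideal.span {f}) (monomial (T11Char7Fan.m 64) (1 : k))) (Ideal.subset_span ⟨T11Char7Fan.m 64, T11Char7Fan.hmA 64, rfl⟩ : (Ideal.Quotient.mk (Ideal.span {f}) (monomial (T11Char7Fan.m 64) (1 : k))) ∈ (Ideal.span ((fun e : Fin 4 →₀ ℕ => Ideal.Quotient.mk (Ideal.span {f}) (monomial e (1 : k))) '' (T11Char7Fan.A : Set (Fin 4 →₀ ℕ)))))) (reesT_mem (Ideal.Quotient.mk (Ideal.span {f}) (monomial (T11Char7Fan.m 64) (1 : k))) (Ideal.subset_span ⟨T11Char7Fan.m 64, T11Char7Fan.hmA 64, rfl⟩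 : (Ideal.Quotient.mk (Ideal.span {f}) (monomial (T11Char7Fan.m 64) (1 : k))) ∈ (Ideal.span ((fun e : Fin 4 →₀ ℕ => Ideal.Quotient.mk (Ideal.span {f}) (monomial e (1 : k))) '' (T11Char7Fan.A : Set (Fin 4 →₀ ℕ)))))) Nat.one_pos).hom g) = reesChartEquiv (Ideal.Quotient.mk (Ideal.span {f}) (monomial (T11Char7Fan.m 64) (1 : k))) (Ideal.subset_span ⟨T11Char7Fan.m 64, T11Char7Fan.hmA 64, rfl⟩ : (Ideal.Quotient.mk (Ideal.span {f}) (monomial (T11Char7Fan.m 64) (1 : k))) ∈ (Ideal.span ((fun e : Fin 4 →₀ ℕ => Ideal.Quotient.mk (Ideal.span {f}) (monomial e (1 : k))) '' (T11Char7Fan.A : Set (Fin 4 →₀ ℕ))))) g))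
    (θ64 : ((MvPolynomial (Fin 4) k ⧸ Ideal.span {(KLocCellKit.evalL k (T11Char7Poly.G 64))}) ≃+* ↥(blowupAlgebra (Ideal.span ((fun e : Fin 4 →₀ ℕ => Ideal.Quotient.mk (Ideal.span {f}) (monomial e (1 : k))) '' (T11Char7Fan.A : Set (Fin 4 →₀ ℕ)))) (Ideal.Quotient.mk (Ideal.span {f}) (monomial (T11Char7Fan.m 64) (1 : k)))))) (hθ64 : (∀ q : MvPolynomial (Fin 4) k, ((θ64 ((Ideal.Quotient.mk (Ideal.span {(KLocCellKit.evalL k (T11Char7Poly.G 64))})) q)) : (Localization.Away (Ideal.Quotient.mk (Ideal.span {f}) (monomial (T11Char7Fan.m 64) (1 : k))))) = (aeval (fun i : Fin 4 => algebraMap (MvPolynomial (Fin 4) k ⧸ Ideal.span {f}) (Localization.Away (Ideal.Quotient.mk (Ideal.span {f}) (monomial (T11Char7Fan.m 64) (1 : k)))) (Ideal.Quotient.mk (Ideal.span {f}) (monomial (T11Char7Fan.a 64 i) (1 : k))) * IsLocalization.Away.invSelf (Ideal.Quotient.mk (Ideal.span {f}) (monomial (T11Char7Fan.m 64) (1 :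 k))))) q))
    (ec : (Γ(affineBlowup (Ideal.span ((fun e : Fin 4 →₀ ℕ => Ideal.Quotient.mk (Ideal.span {f}) (monomial e (1 : k))) '' (T11Char7Fan.A : Set (Fin 4 →₀ ℕ)))), (Proj.basicOpen (reesGrading (Ideal.span ((fun e : Fin 4 →₀ ℕ => Ideal.Quotient.mk (Ideal.span {f}) (monomial e (1 : k))) '' (T11Char7Fan.A : Set (Fin 4 →₀ ℕ))))) (reesT (I := (Ideal.span ((fun e : Fin 4 →₀ ℕ => Ideal.Quotient.mk (Ideal.span {f}) (monomial e (1 : k))) '' (T11Char7Fan.A : Set (Fin 4 →₀ ℕ))))) (Ideal.Quotient.mk (Ideal.span {f}) (monomial (T11Char7Fan.m c) (1 : k))) (Ideal.subset_span ⟨T11Char7Fan.m c, T11Char7Fan.hmA c, rfl⟩ : (Ideal.Quotient.mk (Ideal.span {f}) (monomial (T11Char7Fan.m c) (1 : k))) ∈ (Ideal.span ((fun e : Fin 4 →₀ ℕ => Ideal.Quotient.mk (Ideal.span {f}) (monomial e (1 : k))) '' (T11Char7Fan.A : Set (Fin 4 →₀ ℕ)))))))) ≃+* ↥(blowupAlgebra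 (Ideal.span ((fun e : Fin 4 →₀ ℕ => Ideal.Quotient.mk (Ideal.span {f}) (monomial e (1 : k))) '' (T11Char7Fan.A : Set (Fin 4 →₀ ℕ)))) (Ideal.Quotient.mk (Ideal.span {f}) (monomial (T11Char7Fan.m c) (1 : k)))))) (heac : (∀ g : HomogeneousLocalization.Away (reesGrading (Ideal.span ((fun e : Fin 4 →₀ ℕ => Ideal.Quotient.mk (Ideal.span {f}) (monomial e (1 : k))) '' (T11Char7Fan.A : Set (Fin 4 →₀ ℕ))))) (reesT (I := (Ideal.span ((fun e : Fin 4 →₀ ℕ => Ideal.Quotient.mk (Ideal.span {f}) (monomial e (1 : k))) '' (T11Char7Fan.A : Set (Fin 4 →₀ ℕ))))) (Ideal.Quotient.mk (Ideal.span {f}) (monomial (T11Char7Fan.m c) (1 : k))) (Ideal.subset_span ⟨T11Char7Fan.m c, T11Char7Fan.hmA c, rfl⟩ : (Ideal.Quotient.mk (Ideal.span {f}) (monomial (T11Char7Fan.m c) (1 : k))) ∈ (Ideal.span ((fun e : Fin 4 →₀ ℕ => Ideal.Quotient.mk (Ideal.span {f}) (monomial e (1 : k))) '' (T11Char7Fan.A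 : Set (Fin 4 →₀ ℕ)))))), ec ((Proj.basicOpenIsoAway (reesGrading (Ideal.span ((fun e : Fin 4 →₀ ℕ => Ideal.Quotient.mk (Ideal.span {f}) (monomial e (1 : k))) '' (T11Char7Fan.A : Set (Fin 4 →₀ ℕ))))) (reesT (I := (Ideal.span ((fun e : Fin 4 →₀ ℕ => Ideal.Quotient.mk (Ideal.span {f}) (monomial e (1 : k))) '' (T11Char7Fan.A : Set (Fin 4 →₀ ℕ))))) (Ideal.Quotient.mk (Ideal.span {f}) (monomial (T11Char7Fan.m c) (1 : k))) (Ideal.subset_span ⟨T11Char7Fan.m c, T11Char7Fan.hmA c, rfl⟩ : (Ideal.Quotient.mk (Ideal.span {f}) (monomial (T11Char7Fan.m c) (1 : k))) ∈ (Ideal.span ((fun e : Fin 4 →₀ ℕ => Ideal.Quotient.mk (Ideal.span {f}) (monomial e (1 : k))) '' (T11Char7Fan.A : Set (Fin 4 →₀ ℕ)))))) (reesT_mem (Ideal.Quotient.mk (Ideal.span {f}) (monomial (T11Char7Fan.m c) (1 : k))) (Ideal.subset_span ⟨T11Char7Fan.m c, T11Char7Fan.hmA c, rfl⟩ : (Ideal.Quotient.mk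 (Ideal.span {f}) (monomial (T11Char7Fan.m c) (1 : k))) ∈ (Ideal.span ((fun e : Fin 4 →₀ ℕ => Ideal.Quotient.mk (Ideal.span {f}) (monomial e (1 : k))) '' (T11Char7Fan.A : Set (Fin 4 →₀ ℕ)))))) Nat.one_pos).hom g) = reesChartEquiv (Ideal.Quotient.mk (Ideal.span {f}) (monomial (T11Char7Fan.m c) (1 : k))) (Ideal.subset_span ⟨T11Char7Fan.m c, T11Char7Fan.hmA c, rfl⟩ : (Ideal.Quotient.mk (Ideal.span {f}) (monomial (T11Char7Fan.m c) (1 : k))) ∈ (Ideal.span ((fun e : Fin 4 →₀ ℕ => Ideal.Quotient.mk (Ideal.span {f}) (monomial e (1 : k))) '' (T11Char7Fan.A : Set (Fin 4 →₀ ℕ))))) g))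
    (θc : ((MvPolynomial (Fin 4) k ⧸ Ideal.span {(KLocCellKit.evalL k (T11Char7Poly.G c))}) ≃+* ↥(blowupAlgebra (Ideal.span ((fun e : Fin 4 →₀ ℕ => Ideal.Quotient.mk (Ideal.span {f}) (monomial e (1 : k))) '' (T11Char7Fan.A : Set (Fin 4 →₀ ℕ)))) (Ideal.Quotient.mk (Ideal.span {f}) (monomial (T11Char7Fan.m c) (1 : k)))))) (hθc : (∀ q : MvPolynomial (Fin 4) k, ((θc ((Ideal.Quotient.mk (Ideal.span {(KLocCellKit.evalL k (T11Char7Poly.G c))})) q)) : (Localization.Away (Ideal.Quotient.mk (Ideal.span {f}) (monomial (T11Char7Fan.m c) (1 : k))))) = (aeval (fun i : Fin 4 => algebraMap (MvPolynomial (Fin 4) k ⧸ Ideal.span {f}) (Localization.Away (Ideal.Quotient.mk (Ideal.span {f}) (monomial (T11Char7Fan.m c) (1 : k)))) (Ideal.Quotient.mk (Ideal.span {f}) (monomial (T11Char7Fan.a c i) (1 : k))) * IsLocalization.Away.invSelf (Ideal.Quotient.mk (Ideal.span {f}) (monomial (T11Char7Fan.m c) (1 : k))))) q))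
    (ξ : ↥(affineBlowup (Ideal.span ((fun e : Fin 4 →₀ ℕ => Ideal.Quotient.mk (Ideal.span {f}) (monomial e (1 : k))) '' (T11Char7Fan.A : Set (Fin 4 →₀ ℕ)))))) (hξ64 : ξ ∈ (Proj.basicOpen (reesGrading (Ideal.span ((fun e : Fin 4 →₀ ℕ => Ideal.Quotient.mk (Ideal.span {f}) (monomial e (1 : k))) '' (T11Char7Fan.A : Set (Fin 4 →₀ ℕ))))) (reesT (I := (Ideal.span ((fun e : Fin 4 →₀ ℕ => Ideal.Quotient.mk (Ideal.span {f}) (monomial e (1 : k))) '' (T11Char7Fan.A : Set (Fin 4 →₀ ℕ))))) (Ideal.Quotient.mk (Ideal.span {f}) (monomial (T11Char7Fan.m 64) (1 : k))) (Ideal.subset_span ⟨T11Char7Fan.m 64, T11Char7Fan.hmA 64, rfl⟩ : (Ideal.Quotient.mk (Ideal.span {f}) (monomial (T11Char7Fan.m 64) (1 : k))) ∈ (Ideal.span ((fun e : Fin 4 →₀ ℕ => Ideal.Quotient.mk (Ideal.span {f}) (monomial e (1 : k))) '' (T11Char7Fan.A : Set (Fin 4 →₀ ℕ))))))))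
    (h64 : ((((⟨(Proj.basicOpen (reesGrading (Ideal.span ((fun e : Fin 4 →₀ ℕ => Ideal.Quotient.mk (Ideal.span {f}) (monomial e (1 : k))) '' (T11Char7Fan.A : Set (Fin 4 →₀ ℕ))))) (reesT (I := (Ideal.span ((fun e : Fin 4 →₀ ℕ => Ideal.Quotient.mk (Ideal.span {f}) (monomial e (1 : k))) '' (T11Char7Fan.A : Set (Fin 4 →₀ ℕ))))) (Ideal.Quotient.mk (Ideal.span {f}) (monomial (T11Char7Fan.m 64) (1 : k))) (Ideal.subset_span ⟨T11Char7Fan.m 64, T11Char7Fan.hmA 64, rfl⟩ : (Ideal.Quotient.mk (Ideal.span {f}) (monomial (T11Char7Fan.m 64) (1 : k))) ∈ (Ideal.span ((fun e : Fin 4 →₀ ℕ => Ideal.Quotient.mk (Ideal.span {f}) (monomial e (1 : k))) '' (T11Char7Fan.A : Set (Fin 4 →₀ ℕ))))))), AffineBlowupChartFrame.isAffineOpen_basicOpen_reesT (Ideal.span ((fun e : Fin 4 →₀ ℕ => Ideal.Quotient.mk (Ideal.span {f}) (monomial e (1 : k))) '' (T11Char7Fan.A : Set (Fin 4 →₀ ℕ))))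 (Ideal.Quotient.mk (Ideal.span {f}) (monomial (T11Char7Fan.m 64) (1 : k))) (Ideal.subset_span ⟨T11Char7Fan.m 64, T11Char7Fan.hmA 64, rfl⟩ : (Ideal.Quotient.mk (Ideal.span {f}) (monomial (T11Char7Fan.m 64) (1 : k))) ∈ (Ideal.span ((fun e : Fin 4 →₀ ℕ => Ideal.Quotient.mk (Ideal.span {f}) (monomial e (1 : k))) '' (T11Char7Fan.A : Set (Fin 4 →₀ ℕ)))))⟩ : (affineBlowup (Ideal.span ((fun e : Fin 4 →₀ ℕ => Ideal.Quotient.mk (Ideal.span {f}) (monomial e (1 : k))) '' (T11Char7Fan.A : Set (Fin 4 →₀ ℕ))))).affineOpens)).2.primeIdealOf ⟨ξ, hξ64⟩).asIdeal).map e64 = (((Ideal.span {x | x ∈ (T11Char3Poly.HS 64).map (KLocCellKit.evalL k)}).map (Ideal.Quotient.mk (Ideal.span {(KLocCellKit.evalL k (T11Char7Poly.G 64))})))).map θ64)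
    (hg64 : KLocCellKit.evalL k (T11Char7Poly.G 64) ∈ Ideal.span {x | x ∈ (T11Char3Poly.HS 64).map (KLocCellKit.evalL k)})
    (hlen64 : (T11Char3Poly.HS 64).length = 3)
    (N64 : Fin 3 → ℕ × List (ℤ × (Fin 4 → ℕ)))
    (hN64 : ∀ i : Fin 3, List.Forall₂ (fun t s : ℤ × (Fin 4 → ℕ) => s.1 = t.1 ∧ (∑ ii : Fin 4, t.2 ii) ≤ (N64 i).1 ∧ ∀ jj : Fin 4, s.2 jj = (∑ ii : Fin 4, t.2 ii * T11Char7Fan.aF 64 ii jj) + ((N64 i).1 - ∑ ii : Fin 4, t.2 ii) * T11Char7Fan.mF 64 jj) ((T11Char3Poly.HS 64).getD i []) (N64 i).2)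
    (hlenc : (T11Char3Poly.HS c).length = 3)
    (Nc : Fin 3 → ℕ × List (ℤ × (Fin 4 → ℕ)))
    (hNc : ∀ j : Fin 3, List.Forall₂ (fun t s : ℤ × (Fin 4 → ℕ) => s.1 = t.1 ∧ (∑ ii : Fin 4, t.2 ii) ≤ (Nc j).1 ∧ ∀ jj : Fin 4, s.2 jj = (∑ ii : Fin 4, t.2 ii * T11Char7Fan.aF c ii jj) + ((Nc j).1 - ∑ ii : Fin 4, t.2 ii) * T11Char7Fan.mF c jj) ((T11Char3Poly.HS c).getD j []) (Nc j).2)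
    (Sl : List (Fin 4)) (r : Fin 4) (μ : Fin 4 → ℕ) (hrS : r ∉ Sl) (hμS : ∀ s ∈ Sl, μ s = 0) (hμr : μ r = 0)
    (hperm : (T11Char3Poly.HS c).Perm (((Sl).map fun s : Fin 4 => [((1 : ℤ), (Pi.single s 1 : Fin 4 → ℕ))]) ++ [[((1 : ℤ), μ + Pi.single r 1), ((1 : ℤ), (0 : Fin 4 → ℕ))]]))
    (GC : List (List (ℤ × (Fin 4 → ℕ)))) (hG : ∀ v ∈ (T11Char7Poly.G c).map (fun t : ℤ × (Fin 4 → ℕ) => t.2) ++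
        ((List.zip GC (T11Char3Poly.HS c)).flatMap fun p : List (ℤ × (Fin 4 → ℕ)) × List (ℤ × (Fin 4 → ℕ)) =>
          p.1.flatMap fun s : ℤ × (Fin 4 → ℕ) => p.2.map fun t : ℤ × (Fin 4 → ℕ) => (s.1 * t.1, s.2 + t.2)).map
          (fun t : ℤ × (Fin 4 → ℕ) => t.2),
      (3 : ℤ) ∣ (((T11Char7Poly.G c).filter fun t : ℤ × (Fin 4 → ℕ) => t.2 = v).map (fun t : ℤ × (Fin 4 → ℕ) => t.1)).sum -
        ((((List.zip GC (T11Char3Poly.HS c)).flatMap fun p : List (ℤ × (Fin 4 → ℕ)) × List (ℤ × (Fin 4 → ℕ)) =>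
          p.1.flatMap fun s : ℤ × (Fin 4 → ℕ) => p.2.map fun t : ℤ × (Fin 4 → ℕ) => (s.1 * t.1, s.2 + t.2)).filter
          fun t : ℤ × (Fin 4 → ℕ) => t.2 = v).map (fun t : ℤ × (Fin 4 → ℕ) => t.1)).sum)
    (C1 : Fin 3 → ℕ × Bool × ℤ × (Fin 4 → ℕ)) (hC1 : ∀ j : Fin 3, (C1 j).1 < 3)
    (hR1 : ∀ j : Fin 3, List.Forall₂ (fun t s : ℤ × (Fin 4 → ℕ) => s.1 = t.1 ∧ ∀ jj : Fin 4, (∑ ii : Fin 4, t.2 ii * T11Char7Fan.aF 64 ii jj) + (Nc j).1 * T11Char7Fan.mF 64 jj = s.2 jj + (∑ ii : Fin 4, t.2 ii) * T11Char7Fan.mF 64 jj) (bif (C1 j).2.1 then (((T11Char3Poly.HS 64).getD (C1 j).1 []).map fun t : ℤ × (Fin 4 → ℕ) => (((C1 j).2.2).1 * t.1, ((C1 j).2.2).2 + t.2)).reverse else (((T11Char3Poly.HS 64).getD (C1 j).1 []).map fun t : ℤ × (Fin 4 → ℕ) => (((C1 j).2.2).1 * t.1, ((C1 j).2.2).2 +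 t.2))) (Nc j).2)
    (C2 : Fin 3 → ℕ × Bool × ℤ × (Fin 4 → ℕ)) (hC2 : ∀ i : Fin 3, (C2 i).1 < 3)
    (hR2 : ∀ i : Fin 3, List.Forall₂ (fun t s : ℤ × (Fin 4 → ℕ) => s.1 = t.1 ∧ ∀ jj : Fin 4, (∑ ii : Fin 4, t.2 ii * T11Char7Fan.aF c ii jj) + (N64 i).1 * T11Char7Fan.mF c jj = s.2 jj + (∑ ii : Fin 4, t.2 ii) * T11Char7Fan.mF c jj) (bif (C2 i).2.1 then (((T11Char3Poly.HS c).getD (C2 i).1 []).map fun t : ℤ × (Fin 4 → ℕ) => (((C2 i).2.2).1 * t.1, ((C2 i).2.2).2 + t.2)).reverse else (((T11Char3Poly.HS c).getD (C2 i).1 []).map fun t : ℤ × (Fin 4 → ℕ) => (((C2 i).2.2).1 * t.1, ((C2 i).2.2).2 + t.2))) (N64 i).2)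
    (u : Fin 4 → ℕ) (K₁ : ℕ) (hKu : ∑ i : Fin 4, u i = K₁ + 1)
    (hu : ∀ j : Fin 4, T11Char7Fan.mF c j + K₁ * T11Char7Fan.mF 64 j = ∑ i : Fin 4, u i * T11Char7Fan.aF 64 i j)
    (huS : ∀ s ∈ [(0 : Fin 4), 2], u s = 0)
    (u' : Fin 4 → ℕ) (K₁' : ℕ) (hKu' : ∑ i : Fin 4, u' i = K₁' + 1)
    (hu' : ∀ j : Fin 4, T11Char7Fan.mF 64 j + K₁' * T11Char7Fan.mF c j = ∑ i : Fin 4, u' i * T11Char7Fan.aF c i j)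
    (hu'S : ∀ s ∈ Sl, u' s = 0) :
    ∃ _ : ξ ∈ (Proj.basicOpen (reesGrading (Ideal.span ((fun e : Fin 4 →₀ ℕ => Ideal.Quotient.mk (Ideal.span {f}) (monomial e (1 : k))) '' (T11Char7Fan.A : Set (Fin 4 →₀ ℕ))))) (reesT (I := (Ideal.span ((fun e : Fin 4 →₀ ℕ => Ideal.Quotient.mk (Ideal.span {f}) (monomial e (1 : k))) '' (T11Char7Fan.A : Set (Fin 4 →₀ ℕ))))) (Ideal.Quotient.mk (Ideal.span {f}) (monomial (T11Char7Fan.m c) (1 : k))) (Ideal.subset_span ⟨T11Char7Fan.m c, T11Char7Fan.hmA c, rfl⟩ : (Ideal.Quotient.mk (Ideal.span {f}) (monomial (T11Char7Fan.m c) (1 : k))) ∈ (Ideal.span ((fun e : Fin 4 →₀ ℕ => Ideal.Quotient.mk (Ideal.span {f}) (monomial e (1 : k))) '' (T11Char7Fan.A : Set (Fin 4 →₀ ℕ))))))), (((Scheme.IdealSheafData.vanishingIdeal (⟨closure ({ξ} : Set ↥(affineBlowup (Ideal.span ((fun e : Fin 4 →₀ ℕ => Ideal.Quotient.mk (Ideal.span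 {f}) (monomial e (1 : k))) '' (T11Char7Fan.A : Set (Fin 4 →₀ ℕ)))))), isClosed_closure⟩ : TopologicalSpace.Closeds ↥(affineBlowup (Ideal.span ((fun e : Fin 4 →₀ ℕ => Ideal.Quotient.mk (Ideal.span {f}) (monomial e (1 : k))) '' (T11Char7Fan.A : Set (Fin 4 →₀ ℕ))))))).ideal (⟨(Proj.basicOpen (reesGrading (Ideal.span ((fun e : Fin 4 →₀ ℕ => Ideal.Quotient.mk (Ideal.span {f}) (monomial e (1 : k))) '' (T11Char7Fan.A : Set (Fin 4 →₀ ℕ))))) (reesT (I := (Ideal.span ((fun e : Fin 4 →₀ ℕ => Ideal.Quotient.mk (Ideal.span {f}) (monomial e (1 : k))) '' (T11Char7Fan.A : Set (Fin 4 →₀ ℕ))))) (Ideal.Quotient.mk (Ideal.span {f}) (monomial (T11Char7Fan.m c) (1 : k))) (Ideal.subset_span ⟨T11Char7Fan.m c, T11Char7Fan.hmA c, rfl⟩ : (Ideal.Quotient.mk (Ideal.span {f}) (monomial (T11Char7Fan.m c) (1 : k))) ∈ (Ideal.span ((fun e : Fin 4 →₀ ℕ => Ideal.Quotient.mk (Ideal.span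 {f}) (monomial e (1 : k))) '' (T11Char7Fan.A : Set (Fin 4 →₀ ℕ))))))), AffineBlowupChartFrame.isAffineOpen_basicOpen_reesT (Ideal.span ((fun e : Fin 4 →₀ ℕ => Ideal.Quotient.mk (Ideal.span {f}) (monomial e (1 : k))) '' (T11Char7Fan.A : Set (Fin 4 →₀ ℕ)))) (Ideal.Quotient.mk (Ideal.span {f}) (monomial (T11Char7Fan.m c) (1 : k))) (Ideal.subset_span ⟨T11Char7Fan.m c, T11Char7Fan.hmA c, rfl⟩ : (Ideal.Quotient.mk (Ideal.span {f}) (monomial (T11Char7Fan.m c) (1 : k))) ∈ (Ideal.span ((fun e : Fin 4 →₀ ℕ => Ideal.Quotient.mk (Ideal.span {f}) (monomial e (1 : k))) '' (T11Char7Fan.A : Set (Fin 4 →₀ ℕ)))))⟩ : (affineBlowup (Ideal.span ((fun e : Fin 4 →₀ ℕ => Ideal.Quotient.mk (Ideal.span {f}) (monomial e (1 : k))) '' (T11Char7Fan.A : Set (Fin 4 →₀ ℕ))))).affineOpens))).map ec = (((Ideal.span {x | x ∈ (T11Char3Poly.HS c).map (KLocCellKit.evalL k)}).map (Ideal.Quotient.mk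 (Ideal.span {(KLocCellKit.evalL k (T11Char7Poly.G c))})))).map θc := by
  have hperm64 : (T11Char3Poly.HS 64).Perm ((([(0 : Fin 4), 2]).map fun s : Fin 4 => [((1 : ℤ), (Pi.single s 1 : Fin 4 → ℕ))]) ++ [[((1 : ℤ), (0 : Fin 4 → ℕ) + Pi.single (3 : Fin 4) 1), ((1 : ℤ), (0 : Fin 4 → ℕ))]]) := by
    decide
  have hgc := evalL_G_mem_span_HS k c GC hG
  haveI hI2 : (((Ideal.span {x | x ∈ (T11Char3Poly.HS c).map (KLocCellKit.evalL k)}).map (Ideal.Quotient.mk (Ideal.span {(KLocCellKit.evalL k (T11Char7Poly.G c))})))).IsPrime := isPrime_I₂ k c (isPrime_span_HS k c Sl r μ hrS hμS hμr hperm) hgc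
  haveI hP : ((((Ideal.span {x | x ∈ (T11Char3Poly.HS c).map (KLocCellKit.evalL k)}).map (Ideal.Quotient.mk (Ideal.span {(KLocCellKit.evalL k (T11Char7Poly.G c))})))).map θc).IsPrime := Ideal.map_isPrime_of_equiv θc
  have hξc : ξ ∈ (Proj.basicOpen (reesGrading (Ideal.span ((fun e : Fin 4 →₀ ℕ => Ideal.Quotient.mk (Ideal.span {f}) (monomial e (1 : k))) '' (T11Char7Fan.A : Set (Fin 4 →₀ ℕ))))) (reesT (I := (Ideal.span ((fun e : Fin 4 →₀ ℕ => Ideal.Quotient.mk (Ideal.span {f}) (monomial e (1 : k))) '' (T11Char7Fan.A : Set (Fin 4 →₀ ℕ))))) (Ideal.Quotient.mk (Ideal.span {f}) (monomial (T11Char7Fan.m c) (1 : k))) (Ideal.subset_span ⟨T11Char7Fan.m c, T11Char7Fan.hmA c, rfl⟩ : (Ideal.Quotient.mk (Ideal.span {f}) (monomial (T11Char7Fan.m c) (1 : k))) ∈ (Ideal.span ((fun e : Fin 4 →₀ ℕ => Ideal.Quotient.mk (Ideal.span {f}) (monomial e (1 : k))) '' (T11Char7Fan.A : Set (Fin 4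 →₀ ℕ))))))) := by
    by_contra hnot
    have hmem := (AffineBlowupChartRestriction.not_mem_basicOpen_iff_div_mem e64 hea64 ξ hξ64 (Ideal.Quotient.mk (Ideal.span {f}) (monomial (T11Char7Fan.m c) (1 : k))) (Ideal.subset_span ⟨T11Char7Fan.m c, T11Char7Fan.hmA c, rfl⟩ : (Ideal.Quotient.mk (Ideal.span {f}) (monomial (T11Char7Fan.m c) (1 : k))) ∈ (Ideal.span ((fun e : Fin 4 →₀ ℕ => Ideal.Quotient.mk (Ideal.span {f}) (monomial e (1 : k))) '' (T11Char7Fan.A : Set (Fin 4 →₀ ℕ)))))).mp hnot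
    rw [h64, div_eq_theta_monomial k f c 64 θ64 hθ64 u K₁ hKu hu] at hmem
    exact theta_monomial_not_mem k f 64 [(0 : Fin 4), 2] 3 0 (by decide) (fun _ _ => rfl) rfl hperm64 hg64 θ64 u huS hmem
  refine ⟨hξc, AffineBlowupChartRestriction.map_ideal_closure_eq_of_memberships e64 hea64 ec heac ξ hξ64 hξc
    (fun i : Fin 3 => (N64 i).1)
    (fun i : Fin 3 => ⟨Polynomial.monomial (N64 i).1 (Ideal.Quotient.mk (Ideal.span {f}) (KLocCellKit.evalL k (N64 i).2)),
      reesAlgebra.monomial_mem.mpr (ChartModelNumerators.mk_evalL_mem_pow f (T11Char7Fan.m 64) (T11Char7Fan.a 64) T11Char7Fan.A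
        (T11Char7Fan.haA 64) (T11Char7Fan.hmA 64) (N64 i).1 ((T11Char3Poly.HS 64).getD i []) (N64 i).2
        (forall₂_rel_of_raw 64 (N64 i).1 _ _ (hN64 i)))⟩)
    (fun i : Fin 3 => ⟨Ideal.Quotient.mk (Ideal.span {f}) (KLocCellKit.evalL k (N64 i).2), by simp⟩)
    (h64.trans_le (map_I₂_le_span_numerators k f 64 θ64 hθ64 hlen64 N64 hN64))
    ((((Ideal.span {x | x ∈ (T11Char3Poly.HS c).map (KLocCellKit.evalL k)}).map (Ideal.Quotient.mk (Ideal.span {(KLocCellKit.evalL k (T11Char7Poly.G c))})))).map θc)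
    (by
      rw [div_eq_theta_monomial k f 64 c θc hθc u' K₁' hKu' hu']
      exact theta_monomial_not_mem k f c Sl r μ hrS hμS hμr hperm hgc θc u' hu'S)
    (fun j : Fin 3 => (Nc j).1)
    (fun j : Fin 3 => ⟨Polynomial.monomial (Nc j).1 (Ideal.Quotient.mk (Ideal.span {f}) (KLocCellKit.evalL k (Nc j).2)),
      reesAlgebra.monomial_mem.mpr (ChartModelNumerators.mk_evalL_mem_pow f (T11Char7Fan.m c) (T11Char7Fan.a c) T11Char7Fan.A
        (T11Char7Fan.haA c) (T11Char7Fan.hmA c) (Nc j).1 ((T11Char3Poly.HS c).getD j []) (Nc j).2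
        (forall₂_rel_of_raw c (Nc j).1 _ _ (hNc j)))⟩)
    (fun j : Fin 3 => ⟨Ideal.Quotient.mk (Ideal.span {f}) (KLocCellKit.evalL k (Nc j).2), by simp⟩)
    (map_I₂_le_span_numerators k f c θc hθc hlenc Nc hNc)
    (fun j : Fin 3 => h64.ge (numerator_mem_map_I₂ k f 64 θ64 hθ64 hlen64 (C1 j).1 (hC1 j) (C1 j).2.1 (C1 j).2.2 (Nc j).1 (Nc j).2
      (ChartModelNumerators.mk_evalL_mem_pow f (T11Char7Fan.m c) (T11Char7Fan.a c) T11Char7Fan.A (T11Char7Fan.haA c) (T11Char7Fan.hmA c)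
        (Nc j).1 ((T11Char3Poly.HS c).getD j []) (Nc j).2 (forall₂_rel_of_raw c (Nc j).1 _ _ (hNc j))) (hR1 j)))
    (fun i : Fin 3 => numerator_mem_map_I₂ k f c θc hθc hlenc (C2 i).1 (hC2 i) (C2 i).2.1 (C2 i).2.2 (N64 i).1 (N64 i).2
      (ChartModelNumerators.mk_evalL_mem_pow f (T11Char7Fan.m 64) (T11Char7Fan.a 64) T11Char7Fan.A (T11Char7Fan.haA 64)
        (T11Char7Fan.hmA 64) (N64 i).1 ((T11Char3Poly.HS 64).getD i []) (N64 i).2 (forall₂_rel_of_raw 64 (N64 i).1 _ _ (hN64 i)))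
      (hR2 i))⟩

end Main

end Summit.ResolutionOfSingularities.ResolutionOfSingularities.Theorems.FInjectiveMacaulayfication.T11Char3R3Charts

end
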